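import Summits.ABC.ABC.Theorems.TwistAmplificationMazurKaneLawLpDefsDE
import Summits.ABC.ABC.Theorems.TwistAmplificationMazurKaneLawRecordDEDefs

/-!
# Crux `TwistAmplification.MazurKaneLaw` (stmt-ABC-2757), line `critical-kloosterman-powerful-moduli`: adapter from the bundle
# `LpHypsDE4` of the generated certificate to the generic LP statement `LpCertDE 3 4 s₀ ((2 + s₀)/4)`

The generated certificate `lp_DE` (files `…RecordLPDE*.lean`) is stated through the hypothesis bundle `LpHypsDE4 s₀ a b c A B C D da db dc σ`
(27 telescope hypotheses at `J = 4` + 21 EXPLICIT eight-way DE disjunctions). This file proves, once and for all, that the GENERIC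
telescope of `LpCertDE 3 4 s₀ Vc` (the three DE families quantified over the pivot levels `i₀ = 0`, `i₁ = 1` and the level set `Q`, with the
eight disjuncts verbatim the conclusion of `dispersion_linear` halved) implies the bundle: the 27 structural hypotheses are identical up to the
cast `((4 : ℕ) : ℝ) = 4`, and each explicit DE disjunction is the generic one at `Q ∈ {{1}, {2}, {3}, {1,2}, {1,3}, {2,3}, {1,2,3}}` with the
`Finset` sums expanded, the disjuncts reordered (`E₁, E₁+g, E₂, E₂+g, E₃, E₃+g, E₄, E₄+g` versus `g = 0 : E₁…E₄`, `g = 1 : E₁…E₄`) and each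
disjunct rearranged linearly (`linarith`). Hence any proof of the bundle form yields `LpCertDE 3 4 s₀ ((2 + s₀)/4)` on `16/9 ≤ s₀ ≤ 2`.
-/

-- `Summit.<Summit>.<Problem>`: the duplicate `ABC.ABC` is deliberate (single-conjunct summit).
set_option linter.dupNamespace false

open Finset

namespace Summit.ABC.ABC.Theorems.MazurKaneLaw

/-- `∑_{j ∈ {1}} f j = f 1` on `Fin 4`. [folklore] -/
theorem de_sumQ1 (f : Fin 4 → ℝ) : ∑ j ∈ ({1} : Finset (Fin 4)), f j = f 1 := Finset.sum_singleton _ _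

/-- `∑_{j ∈ {2}} f j = f 2` on `Fin 4`. [folklore] -/
theorem de_sumQ2 (f : Fin 4 → ℝ) : ∑ j ∈ ({2} : Finset (Fin 4)), f j = f 2 := Finset.sum_singleton _ _

/-- `∑_{j ∈ {3}} f j = f 3` on `Fin 4`. [folklore] -/
theorem de_sumQ3 (f : Fin 4 → ℝ) : ∑ j ∈ ({3} : Finset (Fin 4)), f j = f 3 := Finset.sum_singleton _ _

/-- `∑_{j ∈ {1,2}} f j = f 1 + f 2` on `Fin 4`. [folklore] -/
theorem de_sumQ12 (f : Fin 4 → ℝ) : ∑ j ∈ ({1, 2} : Finset (Fin 4)), f j = f 1 + f 2 := Finset.sum_pair (by decide)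

/-- `∑_{j ∈ {1,3}} f j = f 1 + f 3` on `Fin 4`. [folklore] -/
theorem de_sumQ13 (f : Fin 4 → ℝ) : ∑ j ∈ ({1, 3} : Finset (Fin 4)), f j = f 1 + f 3 := Finset.sum_pair (by decide)

/-- `∑_{j ∈ {2,3}} f j = f 2 + f 3` on `Fin 4`. [folklore] -/
theorem de_sumQ23 (f : Fin 4 → ℝ) : ∑ j ∈ ({2, 3} : Finset (Fin 4)), f j = f 2 + f 3 := Finset.sum_pair (by decide)

/-- `∑_{j ∈ {1,2,3}} f j = f 1 + f 2 + f 3` on `Fin 4`. [folklore] -/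
theorem de_sumQ123 (f : Fin 4 → ℝ) : ∑ j ∈ ({1, 2, 3} : Finset (Fin 4)), f j = f 1 + f 2 + f 3 := by
  rw [Finset.sum_insert (by decide), Finset.sum_pair (by decide), add_assoc]

/-- The values of the numerals `0, 1, 2, 3 : Fin 4` cast to `ℝ`. [folklore] -/
theorem de_fin4_casts : (((0 : Fin 4) : ℕ) : ℝ) = 0 ∧ (((1 : Fin 4) : ℕ) : ℝ) = 1 ∧ (((2 : Fin 4) : ℕ) : ℝ) = 2 ∧ (((3 : Fin 4) : ℕ) : ℝ) = 3 := by
  refine ⟨?_, ?_, ?_, ?_⟩ <;> norm_num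

set_option maxHeartbeats 400000 in
/-- **Adapter** (registered sub-goal `lpCertDE_of_lpHypsDE4` of crux stmt-ABC-2757): a proof of the LP in the bundle form
`LpHypsDE4 s₀ … → D ≤ (2 + s₀)/4 + 3σ` (as the generated certificate `lp_DE` provides) gives the generic LP statement
`LpCertDE 3 4 s₀ ((2 + s₀)/4)` for `16/9 ≤ s₀ ≤ 2`. [folklore] -/
theorem lpCertDE_of_lpHypsDE4 : (∀ s₀ : ℝ, (16 / 9 : ℝ) ≤ s₀ → s₀ ≤ 2 → ∀ (a b c : Fin 4 → ℝ) (A B C D da db dc σ : ℝ), Summit.ABC.ABC.Theorems.MazurKaneLaw.Toolkit.LpHypsDE4 s₀ a b c A B C D da db dc σ → D ≤ (2 + s₀) / 4 + 3 * σ) → ∀ s₀ : ℝ, (16 / 9 : ℝ) ≤ s₀ → s₀ ≤ 2 → Summit.ABC.ABC.Theorems.MazurKaneLaw.Toolkit.LpCertDE 3 4 s₀ ((2 + s₀) / 4) := by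
  intro hlp s₀ hslo hshi  a b c A B C D da db dc σ ha hb hc hTa0 hTb0 hTc0 hWa' hda0 hda1 hWb' hdb0 hdb1 hWc' hdc0 hdcs hs0 hsm hL hT_ab hT_ac hT_bc hDt hF hG hQa hQb hQc hDEa hDEb hDEc
  have hWa0 : ((4 : ℝ) + 1) * A - ∑ k : Fin 4, ((4 : ℝ) - ((k : ℕ) : ℝ)) * a k ≤ 1 - da := by simpa only [Nat.cast_ofNat] using hWa'
  have hWb0 : ((4 : ℝ) + 1) * B - ∑ k : Fin 4, ((4 : ℝ) - ((k : ℕ) : ℝ)) * b k ≤ 1 - db := by simpa only [Nat.cast_ofNat] using hWb'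
  have hWc0 : ((4 : ℝ) + 1) * C - ∑ k : Fin 4, ((4 : ℝ) - ((k : ℕ) : ℝ)) * c k ≤ 1 - dc := by simpa only [Nat.cast_ofNat] using hWc'
  obtain ⟨-, hv1, hv2, hv3⟩ := de_fin4_casts
  refine hlp s₀ hslo hshi a b c A B C D da db dc σ ⟨ha, hb, hc, hTa0, hTb0, hTc0, hWa0, hda0, hda1, hWb0, hdb0, hdb1, hWc0, hdc0, hdcs, hs0, hsm, hL, hT_ab, hT_ac, hT_bc, hDt, hF, hG, hQa, hQb, hQc, ?_, ?_, ?_, ?_, ?_, ?_, ?_, ?_, ?_, ?_, ?_, ?_, ?_, ?_, ?_, ?_, ?_, ?_, ?_, ?_, ?_⟩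
  · -- host a, Q = {1}
    have h := hDEa 0 1 rfl rfl {1}
    simp only [de_sumQ1, hv1] at h
    rcases h with h | h | h | h | h | h | h | h
    · exact Or.inl (by linarith only [h])
    · exact Or.inr (Or.inr (Or.inl (by linarith only [h])))
    · exact Or.inr (Or.inr (Or.inr (Or.inr (Or.inl (by linarith only [h])))))
    · exact Or.inr (Or.inr (Or.inr (Or.inr (Or.inr (Or.inr (Or.inl (by linarith only [h])))))))
    · exact Or.inr (Or.inl (by linarith only [h]))
    · exact Or.inr (Or.inr (Or.inr (Or.inl (by linarith only [h]))))
    · exact Or.inr (Or.inr (Or.inr (Or.inr (Or.inr (Or.inl (by linarith only [h]))))))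
    · exact Or.inr (Or.inr (Or.inr (Or.inr (Or.inr (Or.inr (Or.inr (by linarith only [h])))))))
  · -- host a, Q = {2}
    have h := hDEa 0 1 rfl rfl {2}
    simp only [de_sumQ2, hv2] at h
    rcases h with h | h | h | h | h | h | h | h
    · exact Or.inl (by linarith only [h])
    · exact Or.inr (Or.inr (Or.inl (by linarith only [h])))
    · exact Or.inr (Or.inr (Or.inr (Or.inr (Or.inl (by linarith only [h])))))
    · exact Or.inr (Or.inr (Or.inr (Or.inr (Or.inr (Or.inr (Or.inl (by linarith only [h])))))))
    · exact Or.inr (Or.inl (by linarith only [h]))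
    · exact Or.inr (Or.inr (Or.inr (Or.inl (by linarith only [h]))))
    · exact Or.inr (Or.inr (Or.inr (Or.inr (Or.inr (Or.inl (by linarith only [h]))))))
    · exact Or.inr (Or.inr (Or.inr (Or.inr (Or.inr (Or.inr (Or.inr (by linarith only [h])))))))
  · -- host a, Q = {3}
    have h := hDEa 0 1 rfl rfl {3}
    simp only [de_sumQ3, hv3] at h
    rcases h with h | h | h | h | h | h | h | h
    · exact Or.inl (by linarith only [h])
    · exact Or.inr (Or.inr (Or.inl (by linarith only [h])))
    · exact Or.inr (Or.inr (Or.inr (Or.inr (Or.inl (by linarith only [h])))))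
    · exact Or.inr (Or.inr (Or.inr (Or.inr (Or.inr (Or.inr (Or.inl (by linarith only [h])))))))
    · exact Or.inr (Or.inl (by linarith only [h]))
    · exact Or.inr (Or.inr (Or.inr (Or.inl (by linarith only [h]))))
    · exact Or.inr (Or.inr (Or.inr (Or.inr (Or.inr (Or.inl (by linarith only [h]))))))
    · exact Or.inr (Or.inr (Or.inr (Or.inr (Or.inr (Or.inr (Or.inr (by linarith only [h])))))))
  · -- host a, Q = {1, 2}
    have h := hDEa 0 1 rfl rfl {1, 2}
    simp only [de_sumQ12, hv1, hv2] at h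
    rcases h with h | h | h | h | h | h | h | h
    · exact Or.inl (by linarith only [h])
    · exact Or.inr (Or.inr (Or.inl (by linarith only [h])))
    · exact Or.inr (Or.inr (Or.inr (Or.inr (Or.inl (by linarith only [h])))))
    · exact Or.inr (Or.inr (Or.inr (Or.inr (Or.inr (Or.inr (Or.inl (by linarith only [h])))))))
    · exact Or.inr (Or.inl (by linarith only [h]))
    · exact Or.inr (Or.inr (Or.inr (Or.inl (by linarith only [h]))))
    · exact Or.inr (Or.inr (Or.inr (Or.inr (Or.inr (Or.inl (by linarith only [h]))))))
    · exact Or.inr (Or.inr (Or.inr (Or.inr (Or.inr (Or.inr (Or.inr (by linarith only [h])))))))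
  · -- host a, Q = {1, 3}
    have h := hDEa 0 1 rfl rfl {1, 3}
    simp only [de_sumQ13, hv1, hv3] at h
    rcases h with h | h | h | h | h | h | h | h
    · exact Or.inl (by linarith only [h])
    · exact Or.inr (Or.inr (Or.inl (by linarith only [h])))
    · exact Or.inr (Or.inr (Or.inr (Or.inr (Or.inl (by linarith only [h])))))
    · exact Or.inr (Or.inr (Or.inr (Or.inr (Or.inr (Or.inr (Or.inl (by linarith only [h])))))))
    · exact Or.inr (Or.inl (by linarith only [h]))
    · exact Or.inr (Or.inr (Or.inr (Or.inl (by linarith only [h]))))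
    · exact Or.inr (Or.inr (Or.inr (Or.inr (Or.inr (Or.inl (by linarith only [h]))))))
    · exact Or.inr (Or.inr (Or.inr (Or.inr (Or.inr (Or.inr (Or.inr (by linarith only [h])))))))
  · -- host a, Q = {2, 3}
    have h := hDEa 0 1 rfl rfl {2, 3}
    simp only [de_sumQ23, hv2, hv3] at h
    rcases h with h | h | h | h | h | h | h | h
    · exact Or.inl (by linarith only [h])
    · exact Or.inr (Or.inr (Or.inl (by linarith only [h])))
    · exact Or.inr (Or.inr (Or.inr (Or.inr (Or.inl (by linarith only [h])))))
    · exact Or.inr (Or.inr (Or.inr (Or.inr (Or.inr (Or.inr (Or.inl (by linarith only [h])))))))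
    · exact Or.inr (Or.inl (by linarith only [h]))
    · exact Or.inr (Or.inr (Or.inr (Or.inl (by linarith only [h]))))
    · exact Or.inr (Or.inr (Or.inr (Or.inr (Or.inr (Or.inl (by linarith only [h]))))))
    · exact Or.inr (Or.inr (Or.inr (Or.inr (Or.inr (Or.inr (Or.inr (by linarith only [h])))))))
  · -- host a, Q = {1, 2, 3}
    have h := hDEa 0 1 rfl rfl {1, 2, 3}
    simp only [de_sumQ123, hv1, hv2, hv3] at h
    rcases h with h | h | h | h | h | h | h | h
    · exact Or.inl (by linarith only [h])
    · exact Or.inr (Or.inr (Or.inl (by linarith only [h])))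
    · exact Or.inr (Or.inr (Or.inr (Or.inr (Or.inl (by linarith only [h])))))
    · exact Or.inr (Or.inr (Or.inr (Or.inr (Or.inr (Or.inr (Or.inl (by linarith only [h])))))))
    · exact Or.inr (Or.inl (by linarith only [h]))
    · exact Or.inr (Or.inr (Or.inr (Or.inl (by linarith only [h]))))
    · exact Or.inr (Or.inr (Or.inr (Or.inr (Or.inr (Or.inl (by linarith only [h]))))))
    · exact Or.inr (Or.inr (Or.inr (Or.inr (Or.inr (Or.inr (Or.inr (by linarith only [h])))))))
  · -- host b, Q = {1}
    have h := hDEb 0 1 rfl rfl {1}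
    simp only [de_sumQ1, hv1] at h
    rcases h with h | h | h | h | h | h | h | h
    · exact Or.inl (by linarith only [h])
    · exact Or.inr (Or.inr (Or.inl (by linarith only [h])))
    · exact Or.inr (Or.inr (Or.inr (Or.inr (Or.inl (by linarith only [h])))))
    · exact Or.inr (Or.inr (Or.inr (Or.inr (Or.inr (Or.inr (Or.inl (by linarith only [h])))))))
    · exact Or.inr (Or.inl (by linarith only [h]))
    · exact Or.inr (Or.inr (Or.inr (Or.inl (by linarith only [h]))))
    · exact Or.inr (Or.inr (Or.inr (Or.inr (Or.inr (Or.inl (by linarith only [h]))))))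
    · exact Or.inr (Or.inr (Or.inr (Or.inr (Or.inr (Or.inr (Or.inr (by linarith only [h])))))))
  · -- host b, Q = {2}
    have h := hDEb 0 1 rfl rfl {2}
    simp only [de_sumQ2, hv2] at h
    rcases h with h | h | h | h | h | h | h | h
    · exact Or.inl (by linarith only [h])
    · exact Or.inr (Or.inr (Or.inl (by linarith only [h])))
    · exact Or.inr (Or.inr (Or.inr (Or.inr (Or.inl (by linarith only [h])))))
    · exact Or.inr (Or.inr (Or.inr (Or.inr (Or.inr (Or.inr (Or.inl (by linarith only [h])))))))
    · exact Or.inr (Or.inl (by linarith only [h]))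
    · exact Or.inr (Or.inr (Or.inr (Or.inl (by linarith only [h]))))
    · exact Or.inr (Or.inr (Or.inr (Or.inr (Or.inr (Or.inl (by linarith only [h]))))))
    · exact Or.inr (Or.inr (Or.inr (Or.inr (Or.inr (Or.inr (Or.inr (by linarith only [h])))))))
  · -- host b, Q = {3}
    have h := hDEb 0 1 rfl rfl {3}
    simp only [de_sumQ3, hv3] at h
    rcases h with h | h | h | h | h | h | h | h
    · exact Or.inl (by linarith only [h])
    · exact Or.inr (Or.inr (Or.inl (by linarith only [h])))
    · exact Or.inr (Or.inr (Or.inr (Or.inr (Or.inl (by linarith only [h])))))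
    · exact Or.inr (Or.inr (Or.inr (Or.inr (Or.inr (Or.inr (Or.inl (by linarith only [h])))))))
    · exact Or.inr (Or.inl (by linarith only [h]))
    · exact Or.inr (Or.inr (Or.inr (Or.inl (by linarith only [h]))))
    · exact Or.inr (Or.inr (Or.inr (Or.inr (Or.inr (Or.inl (by linarith only [h]))))))
    · exact Or.inr (Or.inr (Or.inr (Or.inr (Or.inr (Or.inr (Or.inr (by linarith only [h])))))))
  · -- host b, Q = {1, 2}
    have h := hDEb 0 1 rfl rfl {1, 2}
    simp only [de_sumQ12, hv1, hv2] at h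
    rcases h with h | h | h | h | h | h | h | h
    · exact Or.inl (by linarith only [h])
    · exact Or.inr (Or.inr (Or.inl (by linarith only [h])))
    · exact Or.inr (Or.inr (Or.inr (Or.inr (Or.inl (by linarith only [h])))))
    · exact Or.inr (Or.inr (Or.inr (Or.inr (Or.inr (Or.inr (Or.inl (by linarith only [h])))))))
    · exact Or.inr (Or.inl (by linarith only [h]))
    · exact Or.inr (Or.inr (Or.inr (Or.inl (by linarith only [h]))))
    · exact Or.inr (Or.inr (Or.inr (Or.inr (Or.inr (Or.inl (by linarith only [h]))))))
    · exact Or.inr (Or.inr (Or.inr (Or.inr (Or.inr (Or.inr (Or.inr (by linarith only [h])))))))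
  · -- host b, Q = {1, 3}
    have h := hDEb 0 1 rfl rfl {1, 3}
    simp only [de_sumQ13, hv1, hv3] at h
    rcases h with h | h | h | h | h | h | h | h
    · exact Or.inl (by linarith only [h])
    · exact Or.inr (Or.inr (Or.inl (by linarith only [h])))
    · exact Or.inr (Or.inr (Or.inr (Or.inr (Or.inl (by linarith only [h])))))
    · exact Or.inr (Or.inr (Or.inr (Or.inr (Or.inr (Or.inr (Or.inl (by linarith only [h])))))))
    · exact Or.inr (Or.inl (by linarith only [h]))
    · exact Or.inr (Or.inr (Or.inr (Or.inl (by linarith only [h]))))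
    · exact Or.inr (Or.inr (Or.inr (Or.inr (Or.inr (Or.inl (by linarith only [h]))))))
    · exact Or.inr (Or.inr (Or.inr (Or.inr (Or.inr (Or.inr (Or.inr (by linarith only [h])))))))
  · -- host b, Q = {2, 3}
    have h := hDEb 0 1 rfl rfl {2, 3}
    simp only [de_sumQ23, hv2, hv3] at h
    rcases h with h | h | h | h | h | h | h | h
    · exact Or.inl (by linarith only [h])
    · exact Or.inr (Or.inr (Or.inl (by linarith only [h])))
    · exact Or.inr (Or.inr (Or.inr (Or.inr (Or.inl (by linarith only [h])))))
    · exact Or.inr (Or.inr (Or.inr (Or.inr (Or.inr (Or.inr (Or.inl (by linarith only [h])))))))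
    · exact Or.inr (Or.inl (by linarith only [h]))
    · exact Or.inr (Or.inr (Or.inr (Or.inl (by linarith only [h]))))
    · exact Or.inr (Or.inr (Or.inr (Or.inr (Or.inr (Or.inl (by linarith only [h]))))))
    · exact Or.inr (Or.inr (Or.inr (Or.inr (Or.inr (Or.inr (Or.inr (by linarith only [h])))))))
  · -- host b, Q = {1, 2, 3}
    have h := hDEb 0 1 rfl rfl {1, 2, 3}
    simp only [de_sumQ123, hv1, hv2, hv3] at h
    rcases h with h | h | h | h | h | h | h | h
    · exact Or.inl (by linarith only [h])
    · exact Or.inr (Or.inr (Or.inl (by linarith only [h])))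
    · exact Or.inr (Or.inr (Or.inr (Or.inr (Or.inl (by linarith only [h])))))
    · exact Or.inr (Or.inr (Or.inr (Or.inr (Or.inr (Or.inr (Or.inl (by linarith only [h])))))))
    · exact Or.inr (Or.inl (by linarith only [h]))
    · exact Or.inr (Or.inr (Or.inr (Or.inl (by linarith only [h]))))
    · exact Or.inr (Or.inr (Or.inr (Or.inr (Or.inr (Or.inl (by linarith only [h]))))))
    · exact Or.inr (Or.inr (Or.inr (Or.inr (Or.inr (Or.inr (Or.inr (by linarith only [h])))))))
  · -- host c, Q = {1}
    have h := hDEc 0 1 rfl rfl {1}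
    simp only [de_sumQ1, hv1] at h
    rcases h with h | h | h | h | h | h | h | h
    · exact Or.inl (by linarith only [h])
    · exact Or.inr (Or.inr (Or.inl (by linarith only [h])))
    · exact Or.inr (Or.inr (Or.inr (Or.inr (Or.inl (by linarith only [h])))))
    · exact Or.inr (Or.inr (Or.inr (Or.inr (Or.inr (Or.inr (Or.inl (by linarith only [h])))))))
    · exact Or.inr (Or.inl (by linarith only [h]))
    · exact Or.inr (Or.inr (Or.inr (Or.inl (by linarith only [h]))))
    · exact Or.inr (Or.inr (Or.inr (Or.inr (Or.inr (Or.inl (by linarith only [h]))))))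
    · exact Or.inr (Or.inr (Or.inr (Or.inr (Or.inr (Or.inr (Or.inr (by linarith only [h])))))))
  · -- host c, Q = {2}
    have h := hDEc 0 1 rfl rfl {2}
    simp only [de_sumQ2, hv2] at h
    rcases h with h | h | h | h | h | h | h | h
    · exact Or.inl (by linarith only [h])
    · exact Or.inr (Or.inr (Or.inl (by linarith only [h])))
    · exact Or.inr (Or.inr (Or.inr (Or.inr (Or.inl (by linarith only [h])))))
    · exact Or.inr (Or.inr (Or.inr (Or.inr (Or.inr (Or.inr (Or.inl (by linarith only [h])))))))
    · exact Or.inr (Or.inl (by linarith only [h]))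
    · exact Or.inr (Or.inr (Or.inr (Or.inl (by linarith only [h]))))
    · exact Or.inr (Or.inr (Or.inr (Or.inr (Or.inr (Or.inl (by linarith only [h]))))))
    · exact Or.inr (Or.inr (Or.inr (Or.inr (Or.inr (Or.inr (Or.inr (by linarith only [h])))))))
  · -- host c, Q = {3}
    have h := hDEc 0 1 rfl rfl {3}
    simp only [de_sumQ3, hv3] at h
    rcases h with h | h | h | h | h | h | h | h
    · exact Or.inl (by linarith only [h])
    · exact Or.inr (Or.inr (Or.inl (by linarith only [h])))
    · exact Or.inr (Or.inr (Or.inr (Or.inr (Or.inl (by linarith only [h])))))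
    · exact Or.inr (Or.inr (Or.inr (Or.inr (Or.inr (Or.inr (Or.inl (by linarith only [h])))))))
    · exact Or.inr (Or.inl (by linarith only [h]))
    · exact Or.inr (Or.inr (Or.inr (Or.inl (by linarith only [h]))))
    · exact Or.inr (Or.inr (Or.inr (Or.inr (Or.inr (Or.inl (by linarith only [h]))))))
    · exact Or.inr (Or.inr (Or.inr (Or.inr (Or.inr (Or.inr (Or.inr (by linarith only [h])))))))
  · -- host c, Q = {1, 2}
    have h := hDEc 0 1 rfl rfl {1, 2}
    simp only [de_sumQ12, hv1, hv2] at h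
    rcases h with h | h | h | h | h | h | h | h
    · exact Or.inl (by linarith only [h])
    · exact Or.inr (Or.inr (Or.inl (by linarith only [h])))
    · exact Or.inr (Or.inr (Or.inr (Or.inr (Or.inl (by linarith only [h])))))
    · exact Or.inr (Or.inr (Or.inr (Or.inr (Or.inr (Or.inr (Or.inl (by linarith only [h])))))))
    · exact Or.inr (Or.inl (by linarith only [h]))
    · exact Or.inr (Or.inr (Or.inr (Or.inl (by linarith only [h]))))
    · exact Or.inr (Or.inr (Or.inr (Or.inr (Or.inr (Or.inl (by linarith only [h]))))))
    · exact Or.inr (Or.inr (Or.inr (Or.inr (Or.inr (Or.inr (Or.inr (by linarith only [h])))))))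
  · -- host c, Q = {1, 3}
    have h := hDEc 0 1 rfl rfl {1, 3}
    simp only [de_sumQ13, hv1, hv3] at h
    rcases h with h | h | h | h | h | h | h | h
    · exact Or.inl (by linarith only [h])
    · exact Or.inr (Or.inr (Or.inl (by linarith only [h])))
    · exact Or.inr (Or.inr (Or.inr (Or.inr (Or.inl (by linarith only [h])))))
    · exact Or.inr (Or.inr (Or.inr (Or.inr (Or.inr (Or.inr (Or.inl (by linarith only [h])))))))
    · exact Or.inr (Or.inl (by linarith only [h]))
    · exact Or.inr (Or.inr (Or.inr (Or.inl (by linarith only [h]))))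
    · exact Or.inr (Or.inr (Or.inr (Or.inr (Or.inr (Or.inl (by linarith only [h]))))))
    · exact Or.inr (Or.inr (Or.inr (Or.inr (Or.inr (Or.inr (Or.inr (by linarith only [h])))))))
  · -- host c, Q = {2, 3}
    have h := hDEc 0 1 rfl rfl {2, 3}
    simp only [de_sumQ23, hv2, hv3] at h
    rcases h with h | h | h | h | h | h | h | h
    · exact Or.inl (by linarith only [h])
    · exact Or.inr (Or.inr (Or.inl (by linarith only [h])))
    · exact Or.inr (Or.inr (Or.inr (Or.inr (Or.inl (by linarith only [h])))))
    · exact Or.inr (Or.inr (Or.inr (Or.inr (Or.inr (Or.inr (Or.inl (by linarith only [h])))))))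
    · exact Or.inr (Or.inl (by linarith only [h]))
    · exact Or.inr (Or.inr (Or.inr (Or.inl (by linarith only [h]))))
    · exact Or.inr (Or.inr (Or.inr (Or.inr (Or.inr (Or.inl (by linarith only [h]))))))
    · exact Or.inr (Or.inr (Or.inr (Or.inr (Or.inr (Or.inr (Or.inr (by linarith only [h])))))))
  · -- host c, Q = {1, 2, 3}
    have h := hDEc 0 1 rfl rfl {1, 2, 3}
    simp only [de_sumQ123, hv1, hv2, hv3] at h
    rcases h with h | h | h | h | h | h | h | h
    · exact Or.inl (by linarith only [h])
    · exact Or.inr (Or.inr (Or.inl (by linarith only [h])))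
    · exact Or.inr (Or.inr (Or.inr (Or.inr (Or.inl (by linarith only [h])))))
    · exact Or.inr (Or.inr (Or.inr (Or.inr (Or.inr (Or.inr (Or.inl (by linarith only [h])))))))
    · exact Or.inr (Or.inl (by linarith only [h]))
    · exact Or.inr (Or.inr (Or.inr (Or.inl (by linarith only [h]))))
    · exact Or.inr (Or.inr (Or.inr (Or.inr (Or.inr (Or.inl (by linarith only [h]))))))
    · exact Or.inr (Or.inr (Or.inr (Or.inr (Or.inr (Or.inr (Or.inr (by linarith only [h])))))))

end Summit.ABC.ABC.Theorems.MazurKaneLaw
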